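import Mathlib
import HarnessLib
import Summits.NavierStokesRegularity.NavierStokesRegularity.Theses.LocalPressureProfileDoor
import Summits.NavierStokesRegularity.NavierStokesRegularity.Theorems.LocalPressureProfileDoorMonotonePressureProfileRigidityRegularOfSmallSlices
import Summits.NavierStokesRegularity.NavierStokesRegularity.Theorems.LocalPressureProfileDoorMonotonePressureProfileRigiditySmallSlice

/-!
# Route `LocalPressureProfileDoor` — crux K2⁺ `MonotonePressureProfileRigidity` (stmt-NavierStokesRegularity-20180) PROVED
# (line `birth`, skeleton `Cruxes/MonotonePressureProfileRigidity/Lines/birth.lean`, sha 86b6bcf2…, now sorry-free)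

Cell ns-regularity-ideate, seat ns-pressure-K2-p1 (LEAD).  **MONOTONE-PRESSURE PROFILE RIGIDITY.**  Let `v` be a profile of the
door class — Type I in time, space–time Type-I decay, continuous on the open backward slab, unit-viscosity Oseen–Duhamel identity
between negative times, divergence-free slices — whose similarity Riesz pressure `P(t,y) = (−t)·Q[v(t)](√(−t) y)` is shift-monotone
toward the apex, `P(e^{−σ}t, y) ≤ P(t, y)` (`t < 0`, `σ ∈ [0,1]`, all `y`).  Then `v` is not backward-singular at the apex `(0,0)`.

The composition is the registered skeleton's `MonotonePressureProfileRigidity_of`, verbatim, with its stubs the landed theorems: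
* `stub_smallSliceOfMonotonePressure` (L) — `…Theorems.LocalPressureProfileDoorMonotonePressureProfileRigiditySmallSlice`: the
  adapted backward kernel AT THE APEX (tree `linearTypeIDriftKernel`) as the line's eternal adjoint weight, the head-pressure budget
  in physical variables with frozen similarity-pressure slices and a Dini form of FTC-2 (no time derivative of the pressure), the
  logarithmic divergence of `∫dt/(−t)` and the kernel floor ⇒ θ-small `(9.17)`-slices at every radius;
* `stub_regularOfSmallSlices` (M) — `…Theorems.LocalPressureProfileDoorMonotonePressureProfileRigidityRegularOfSmallSlices`: one such
  slice ⇒ regular apex (Pineau–Vicol Lemma 9.4 + §9.2);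
* `stub_rung_dssSteadyPressure` (BC5 rung, not consumed) — `…Theorems.LocalPressureProfileDoorMonotonePressureProfileRigidityRungDssSteadyPressure`.
Where the Oseen–Duhamel clause is consumed: in both stubs, at `isTypeIAncientMild_of_class` (the refuter's load-bearing certificates
`…MonotonePressureProfileRigidity.Negative.*_false_without_mild`, p513265/p518176, show it must be).

WHAT THIS IS NOT: not a claim about Navier–Stokes regularity and not a Type-I Liouville theorem (10661 untouched) — the crux of a
CONDITIONAL door route: the pressure monotonicity is a hypothesis (bears_on LADDER-NS N0, rung N0-LocalTubeDoorPressureProfile).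
-/

set_option linter.dupNamespace false -- the summit and its sub-problem share the name (CONVENTIONS §1)

namespace Summit.NavierStokesRegularity.NavierStokesRegularity.Theorems.LocalPressureProfileDoorMonotonePressureProfileRigidity

open Summit.NavierStokesRegularity.NavierStokesRegularity.Theorems

/-- **Crux K2⁺ `MonotonePressureProfileRigidity` of route `LocalPressureProfileDoor` PROVED** — the registered skeleton's
composition `MonotonePressureProfileRigidity_of` (K2⁺ ⇐ stub 1 → stub 2), verbatim, with the stubs the LANDED tree theorems
`…LocalPressureProfileDoorMonotonePressureProfileRigiditySmallSlice.stub_smallSliceOfMonotonePressure` (L: eternal head-pressure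
budget against the adapted backward kernel at the apex ⇒ θ-small enstrophy slices at every similarity radius) and
`…LocalPressureProfileDoorMonotonePressureProfileRigidityRegularOfSmallSlices.stub_regularOfSmallSlices` (M: one such slice ⇒
regular apex, Pineau–Vicol Lemma 9.4 + §9.2).  Concludes the route decl BY NAME.  (The BC5 rung
`…RungDssSteadyPressure.stub_rung_dssSteadyPressure`, p520106, is not consumed.)
[cite: Tsai1998, §5; PineauVicol2026, Theorem 1.9 and (9.17), arXiv:2607.09619] -/
theorem monotonePressureProfileRigidity_proof :
    Summit.NavierStokesRegularity.NavierStokesRegularity.Theses.LocalPressureProfileDoor.MonotonePressureProfileRigidity := by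
  intro C D v hrate hdecay hcont hmild hdiv hmono
  exact LocalPressureProfileDoorMonotonePressureProfileRigidityRegularOfSmallSlices.stub_regularOfSmallSlices C D v hrate hdecay
    hcont hmild hdiv
    (LocalPressureProfileDoorMonotonePressureProfileRigiditySmallSlice.stub_smallSliceOfMonotonePressure C D v hrate hdecay hcont
      hmild hdiv hmono)

end Summit.NavierStokesRegularity.NavierStokesRegularity.Theorems.LocalPressureProfileDoorMonotonePressureProfileRigidity
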